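import Summits.ABC.ABC.Theorems.CuspFieldPencilGoldenFromNFPencil
import Summits.ABC.ABC.Theorems.YuMatveevShapeRatCloses
import Summits.ABC.ABC.Theorems.PlacewiseSzpiroSingleTowerSzpiroBakerSinglePlace
import Literature.NumberTheory.DiophantineGeometry.PastenSubexpPlaces
import Literature.Barriers.ABC.BakerMethodBoundsThreeRoutesProofs
import Literature.Barriers.ABC.BakerMethodBoundsStewartYuProofs
import Literature.Barriers.ABC.BakerMethodBoundsStewartTijdemanProofs
import HarnessLib

/-!
# STUB-IDEAS sketch · `stub_splitCuspTriple` · ideator k1 · GEN 5 — FAMILY 1 (RECOGNISE & IMPORT):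
# the MERGED MINIMAL LINE with import receipts

Crux `GoldenCuspShadow` (stmt-ABC-26026), route `CuspFieldPencil`, skeleton sha a4ca286a….
STATUS (GEN 5): **COMPLETE — `lean check` rc 0, ZERO `sorry`, zero warnings; the audit block reports
`proof-of-item closed: true` for `goldenCuspShadow_holds : CuspFieldPencil.GoldenCuspShadow`.** Every helper
lemma of the merged line (k1 ∪ k2 ∪ k3, gens 2–5, all seats converged) is PROVED below; §1 keeps the
IMPORT RECEIPTS (one-line instantiations of the tree theorems the line leans on, kernel-checked), §7 the
composition ⇒ `RouteU` ⇒ `RouteW` ⇒ `CuspMinRadBound` ⇒ STUB ∧ CRUX. The Theorems-shaped copy (receipts and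
sanity `example`s stripped, namespace `Summit.ABC.ABC.Theorems.GoldenCuspShadowBaker`, final decls
`stub_splitCuspTriple` verbatim + `goldenCuspShadow_proof`) is `CuspFieldPencilGoldenCuspShadow.lean` next to this file.

THE IMPORT (one sentence). `ξ₀ = −Q/w²` (`Q = u² − 11uw − w²`) is an `S`-unit for `S = primes(w·Q)` and
`1 − ξ₀ = u(u − 11w)/w²`; the tree's approximation theorem at ONE rational point
(`Pasten.approx_div`, fed by the KERNEL THEOREM `approximationBound_rat_holds : ∃ K ≥ 1, PastenApproximationBound K`)
bounds `−log|1 − ξ₀|_v` at `v = ∞` and at every `p`, with the constant `Θ₀ = theta K |Q| w² 0`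
generated by the primes of `w·Q` ONLY; reading the `p`-adic clause at the primes of `u` and the
archimedean clause once gives `log max(|u|,|w|) ≤ log 12 + Θ₀·Y·(1 + 3 Σ_{p∣u} p)`, and `Θ₀ ≤ K·C·R^η`
(`SingleTowerSzpiroLine.theta_zero_le_mul_rpow`), `1 + 3Σ_{p∣u} p ≤ 4 rad u`, self-improvement
(`Literature.Barriers.ABC.le_of_le_mul_log_max`) give `RouteU : log H ≤ κ_ε R^ε rad u`; the cusp swap
`(u,w) ↦ (w,−u)` gives `RouteW`; `min(rad u, rad w) ≤ (rad u rad w)^{1/2}` gives the stub AND the crux.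
-/

set_option linter.dupNamespace false
set_option linter.unusedVariables false

noncomputable section

open Finset Real Height
open Literature.NumberTheory.DiophantineGeometry
open Literature.NumberTheory.DiophantineGeometry.Dioph
open Literature.NumberTheory.DiophantineGeometry.Pasten
open Literature.Barriers.ABC
open Summit.ABC.ABC.Theorems
open Summit.ABC.ABC.Theorems.GoldenFromNFPencil

namespace Summit.ABC.ABC.Cruxes.GoldenCuspShadow.SplitK1G5

/-! ## §0 Statements (same TEXT as the other seats' `RouteU` / `RouteW` / `CuspMinRadBound`, so the gate dedups) -/

/-- The registered stub signature `stub_splitCuspTriple`, verbatim. -/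
def StubSplit : Prop :=
  ∀ ε : ℝ, 0 < ε → ∃ κ : ℝ, ∀ u w : ℤ, IsCoprime u w → u * w * (u ^ 2 - 11 * u * w - w ^ 2) ≠ 0 → Real.log (max (|(u : ℝ)|) (|(w : ℝ)|)) ≤ κ * (((UniqueFactorizationMonoid.radical (u * w * (u ^ 2 - 11 * u * w - w ^ 2))).natAbs : ℕ) : ℝ) ^ (ε : ℝ) * (((((UniqueFactorizationMonoid.radical u).natAbs : ℕ) : ℝ) * (((UniqueFactorizationMonoid.radical w).natAbs : ℕ) : ℝ)) ^ (2 / 3 : ℝ) * (((UniqueFactorizationMonoid.radical (u ^ 2 - 11 * u * w - w ^ 2)).natAbs : ℕ) : ℝ) ^ (1 / 3 : ℝ))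

/-- `Q(u,w) = u² − 11uw − w²` (the conjugate-cusp pair, never factorised on this line). -/
abbrev Q (u w : ℤ) : ℤ := u ^ 2 - 11 * u * w - w ^ 2

/-- `H(u,w) = max(|u|,|w|)` as a real number. -/
abbrev H (u w : ℤ) : ℝ := max |(u : ℝ)| |(w : ℝ)|

/-- The dirty member `M = u(u − 11w) = w² + Q` (`t0`). -/
abbrev Mem (u w : ℤ) : ℤ := u * (u - 11 * w)

/-- `Θ₀` of the cusp-0 call: Pasten's `Θ` at threshold `0` for the clean pair `(|Q|, w²)`. -/
abbrev Th (K : ℝ) (u w : ℤ) : ℝ := theta K (Q u w).natAbs (w.natAbs ^ 2) 0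

/-- `Y` of the call: `log max(e, log|Q| + log w²)` (`h(ξ₀) ≤ log|Q| + log w²`). -/
abbrev Ycall (u w : ℤ) : ℝ :=
  Real.log (max (Real.exp 1) (Real.log (((Q u w).natAbs : ℕ) : ℝ) + Real.log (((w.natAbs ^ 2 : ℕ)) : ℝ)))

/-- `rad u`, `R = rad(u·w·Q)` as reals (spelled out everywhere below; these abbrevs are for docstrings). -/
abbrev radR (z : ℤ) : ℝ := (((UniqueFactorizationMonoid.radical z).natAbs : ℕ) : ℝ)

/-- ONE-CUSP TARGET at `t = 0`: `log H ≤ κ_ε · rad(uwQ)^ε · rad u`. -/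
def RouteU : Prop :=
  ∀ ε : ℝ, 0 < ε → ∃ κ : ℝ, ∀ u w : ℤ, IsCoprime u w → u * w * (u ^ 2 - 11 * u * w - w ^ 2) ≠ 0 →
    Real.log (max (|(u : ℝ)|) (|(w : ℝ)|)) ≤
      κ * (((UniqueFactorizationMonoid.radical (u * w * (u ^ 2 - 11 * u * w - w ^ 2))).natAbs : ℕ) : ℝ) ^ (ε : ℝ) *
        (((UniqueFactorizationMonoid.radical u).natAbs : ℕ) : ℝ)

/-- ONE-CUSP TARGET at `t = ∞`. -/
def RouteW : Prop :=
  ∀ ε : ℝ, 0 < ε → ∃ κ : ℝ, ∀ u w : ℤ, IsCoprime u w → u * w * (u ^ 2 - 11 * u * w - w ^ 2) ≠ 0 →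
    Real.log (max (|(u : ℝ)|) (|(w : ℝ)|)) ≤
      κ * (((UniqueFactorizationMonoid.radical (u * w * (u ^ 2 - 11 * u * w - w ^ 2))).natAbs : ℕ) : ℝ) ^ (ε : ℝ) *
        (((UniqueFactorizationMonoid.radical w).natAbs : ℕ) : ℝ)

/-- The min-form. -/
def CuspMinRadBound : Prop :=
  ∀ ε : ℝ, 0 < ε → ∃ κ : ℝ, ∀ u w : ℤ, IsCoprime u w → u * w * (u ^ 2 - 11 * u * w - w ^ 2) ≠ 0 →
    Real.log (max (|(u : ℝ)|) (|(w : ℝ)|)) ≤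
      κ * (((UniqueFactorizationMonoid.radical (u * w * (u ^ 2 - 11 * u * w - w ^ 2))).natAbs : ℕ) : ℝ) ^ (ε : ℝ) *
        min ((((UniqueFactorizationMonoid.radical u).natAbs : ℕ) : ℝ))
            ((((UniqueFactorizationMonoid.radical w).natAbs : ℕ) : ℝ))

/-! ## §1 IMPORT RECEIPTS — the tree theorems the line leans on, instantiated (kernel-checked, no sorry) -/

section Receipts

/-- R0 · the ENGINE is a theorem of the tree (route YuMatveevShapeRat, closed): no hypothesis, no named fact. -/
example : ∃ K : ℝ, 1 ≤ K ∧ PastenApproximationBound K := approximationBound_rat_holds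

/-- R1 · the ONE CALL elaborates against clean data `(y, z) = (|Q|, w²)` with either sign. -/
example {K : ℝ} (hK : 1 ≤ K) (hP : PastenApproximationBound K) {y z : ℕ} (hy : y ≠ 0) (hz : z ≠ 0)
    (hyz : y.Coprime z) (h1 : 1 < y * z) {ζ : ℚ} (hζ : ζ = 1 ∨ ζ = -1) (hξ : ζ * ((y : ℚ) / z) ≠ 1) :
    (-Real.log |((1 - ζ * ((y : ℚ) / z) : ℚ) : ℝ)| <
        theta K y z 0 * Real.log (max (Real.exp 1) (logHeight₁ (ζ * ((y : ℚ) / z))))) ∧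
    ∀ p : ℕ, p.Prime → (padicValRat p (1 - ζ * ((y : ℚ) / z)) : ℝ) * Real.log p <
        theta K y z 0 * ((p / Real.log p) * Real.log (max (Real.exp 1) (p * logHeight₁ (ζ * ((y : ℚ) / z))))) :=
  approx_div hK hP hy hz hyz h1 0 hζ hξ

/-- R2 · height of the point: `h(±y/z) ≤ log y + log z`. -/
example {y z : ℕ} (hy : y ≠ 0) (hz : z ≠ 0) {ζ : ℚ} (hζ : ζ = 1 ∨ ζ = -1) :
    logHeight₁ (ζ * ((y : ℚ) / z)) ≤ Real.log y + Real.log z := logHeight₁_sign_mul_div_le hy hz hζ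

/-- R3 · `Θ₀` is explicit: `K^{ω(yz)+1} ∏_{p ∣ yz} log p`, non-negative. -/
example (K : ℝ) {y z : ℕ} (hy : y ≠ 0) (hz : z ≠ 0) (hyz : y.Coprime z) :
    theta K y z 0 = K ^ ((y * z).primeFactors.card + 1) * ∏ p ∈ (y * z).primeFactors, Real.log p :=
  theta_zero_eq K hy hz hyz
example {K : ℝ} (hK : 1 ≤ K) (y z : ℕ) : 0 ≤ theta K y z 0 := theta_nonneg (zero_le_one.trans hK) y z 0

/-- R4 · `Θ₀ ≤ K·C·rad^η` — ONE call, with `(u,v,a,b,c) := (y, z, y, z, d)`, `d = |u|`. -/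
example {K C η : ℝ} (hK : 1 ≤ K) (hη : 0 ≤ η)
    (hC : ∀ S : Finset ℕ, (∀ p ∈ S, p.Prime) → ∏ p ∈ S, K * Real.log p / (p : ℝ) ^ η ≤ C)
    {y z d : ℕ} (hy : y ≠ 0) (hz : z ≠ 0) (hyz : y.Coprime z) (h0 : y * z * d ≠ 0) :
    theta K y z 0 ≤ K * C * (rad y z d : ℝ) ^ η :=
  SingleTowerSzpiroLine.theta_zero_le_mul_rpow hK hη hC hy hz hyz (dvd_mul_right (y * z) d) h0

/-- R5 · the constant `C = C(K, η)` exists. -/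
example {A η : ℝ} (hA : 0 ≤ A) (hη : 0 < η) :
    ∃ C : ℝ, 1 ≤ C ∧ ∀ S : Finset ℕ, (∀ p ∈ S, p.Prime) → ∏ p ∈ S, A * Real.log p / (p : ℝ) ^ η ≤ C :=
  SingleTowerSzpiroLine.exists_prod_mul_log_div_rpow_le hA hη

/-- R6 · per-prime numerics of the `p`-adic clause (the last lines of `Pasten.padic_bound_a`). -/
example {p t : ℝ} (hp : 1 ≤ p) :
    Real.log (max (Real.exp 1) (p * t)) ≤ Real.log p + Real.log (max (Real.exp 1) t) := log_max_exp_mul_le hp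
example {p Y : ℝ} (hp : 2 ≤ p) (hY : 1 ≤ Y) : p / Real.log p * (Real.log p + Y) ≤ 3 * p * Y :=
  div_log_mul_add_le hp hY
example (t : ℝ) : 1 ≤ Real.log (max (Real.exp 1) t) := one_le_log_max_exp t
example {t₁ t₂ : ℝ} (h : t₁ ≤ t₂) : Real.log (max (Real.exp 1) t₁) ≤ Real.log (max (Real.exp 1) t₂) :=
  log_max_exp_mono h

/-- R7 · `log d = Σ_{p ∣ d} ν_p(d) log p`; `Σ_{p ∈ S} p ≤ ∏_{p ∈ S} p`. -/
example {n : ℕ} (hn : n ≠ 0) : Real.log n = ∑ p ∈ n.primeFactors, (n.factorization p : ℝ) * Real.log p :=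
  log_eq_sum_factorization_mul_log hn
example {s : Finset ℕ} (hs : ∀ p ∈ s, 2 ≤ p) : ∑ p ∈ s, p ≤ ∏ p ∈ s, p := sum_le_prod_of_two_le hs

/-- R8 · self-improvement and `log x ≤ x^ε/ε` (the endgame). -/
example {y M : ℝ} (hM : 1 ≤ M) (h : y ≤ M * Real.log (max (Real.exp 1) (2 * y))) :
    y ≤ 2 * M * Real.log (4 * M) := le_of_le_mul_log_max hM h
example {x ε : ℝ} (hx : 0 ≤ x) (hε : 0 < ε) : Real.log x ≤ x ^ ε / ε := Real.log_le_rpow_div hx hε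

/-- R9 · integer bookkeeping already in the tree for THIS form. -/
example {u w : ℤ} (h : IsCoprime u w) : IsCoprime w (u ^ 2 - 11 * u * w - w ^ 2) := isCoprime_quadForm_right h
example {u w : ℤ} (h : IsCoprime u w) : IsCoprime u (u ^ 2 - 11 * u * w - w ^ 2) := isCoprime_quadForm_left h
example {u w : ℤ} (h : IsCoprime u w) :
    (UniqueFactorizationMonoid.radical (u * w * (u ^ 2 - 11 * u * w - w ^ 2))).natAbs =
      (UniqueFactorizationMonoid.radical u).natAbs * (UniqueFactorizationMonoid.radical w).natAbs *
        (UniqueFactorizationMonoid.radical (u ^ 2 - 11 * u * w - w ^ 2)).natAbs := natAbs_radical_prod h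

/-- R10 · Mathlib valuation API used by `orl_padic_dvd` (names pinned). -/
example (p : ℕ) [Fact p.Prime] {q r : ℚ} (hq : q ≠ 0) (hr : r ≠ 0) :
    padicValRat p (q / r) = padicValRat p q - padicValRat p r := padicValRat.div hq hr
example (p : ℕ) [Fact p.Prime] (z : ℤ) : padicValRat p (z : ℚ) = padicValInt p z := padicValRat.of_int
example (p : ℕ) [Fact p.Prime] {a b : ℤ} (ha : a ≠ 0) (hb : b ≠ 0) :
    padicValInt p (a * b) = padicValInt p a + padicValInt p b := padicValInt.mul ha hb
example (p : ℕ) [Fact p.Prime] {z : ℤ} (h : ¬(p : ℤ) ∣ z) : padicValInt p z = 0 := padicValInt.eq_zero_of_not_dvd h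
example (p : ℕ) (z : ℤ) : padicValInt p z = padicValNat p z.natAbs := rfl
example {n p : ℕ} (hp : p.Prime) : n.factorization p = padicValNat p n := Nat.factorization_def n hp
example (a : ℤ) : a.sign * (a.natAbs : ℤ) = a := Int.sign_mul_natAbs a
example (a b : ℤ) : (a * b).natAbs = a.natAbs * b.natAbs := Int.natAbs_mul a b

end Receipts

/-! ## §2 Algebra of the cusp data (proved: `ring` / `decide`) -/

/-- `t0 : w² + Q = u(u − 11w)` — the hidden relation at the cusp `t = 0`. -/
theorem t0 (u w : ℤ) : w ^ 2 + Q u w = Mem u w := by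
  simp only [Q, Mem]; ring

/-- The cusp swap `(u, w) ↦ (w, −u)` (`t ↦ −1/t`) fixes the product `u·w·Q` literally. -/
theorem prod_swap (u w : ℤ) : w * (-u) * Q w (-u) = u * w * Q u w := by
  simp only [Q]; ring

/-! ## §3 FILE A — the two GENERIC one-ratio place lemmas (ORL; reusable by the sibling stub and any
2-rational-cusp pencil). Data: clean coprime `y, z ∈ ℕ`, a sign `s = ±1`; the dirty member is
DETERMINED, `m = z − s·y` (`1 − s·y/z = m/z`), and is never factorised. Proof = the tree proofs of
`Pasten.arch_bound` / `Pasten.padic_bound_a` with `a/c` replaced by `m/z` (same lines). -/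

/-- **A1 · `orl_arch` [S, ≈30 ll.]** archimedean clause of `approx_div` at `ξ = s·y/z`:
`log z − log|m| < Θ₀(y,z) · log max(e, log y + log z)` (`−log|m/z| = log z − log|m|`, R2, `log_max_exp_mono`). -/
theorem orl_arch {K : ℝ} (hK : 1 ≤ K) (hP : PastenApproximationBound K) {y z : ℕ} (hy : y ≠ 0) (hz : z ≠ 0)
    (hyz : y.Coprime z) (h1 : 1 < y * z) {s : ℤ} (hs : s = 1 ∨ s = -1) (hm : (z : ℤ) - s * y ≠ 0) :
    Real.log z - Real.log |(((z : ℤ) - s * y : ℤ) : ℝ)| <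
      theta K y z 0 * Real.log (max (Real.exp 1) (Real.log y + Real.log z)) := by
  set m : ℤ := (z : ℤ) - s * y with hm_def
  have hz' : (z : ℚ) ≠ 0 := by exact_mod_cast hz
  have hzpos : (0 : ℝ) < z := by exact_mod_cast Nat.pos_of_ne_zero hz
  have hm' : (m : ℝ) ≠ 0 := by exact_mod_cast hm
  have hζ : (s : ℚ) = 1 ∨ (s : ℚ) = -1 := by
    rcases hs with hs1 | hs1 <;> simp [hs1]
  have hsub : (1 : ℚ) - (s : ℚ) * ((y : ℚ) / z) = (m : ℚ) / z := by
    rw [eq_div_iff hz', sub_mul, one_mul, mul_assoc, div_mul_cancel₀ _ hz', hm_def]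
    push_cast; ring
  have hξ1 : (s : ℚ) * ((y : ℚ) / z) ≠ 1 := by
    intro h'
    have h0 : (m : ℚ) / z = 0 := by rw [← hsub, h', sub_self]
    rcases div_eq_zero_iff.mp h0 with h'' | h''
    · exact hm (by exact_mod_cast h'')
    · exact hz' h''
  obtain ⟨hA, -⟩ := approx_div hK hP hy hz hyz h1 0 hζ hξ1
  rw [hsub] at hA
  have hcast : ((((m : ℚ) / z : ℚ)) : ℝ) = (m : ℝ) / z := by
    rw [Rat.cast_div, Rat.cast_intCast, Rat.cast_natCast]
  rw [hcast, abs_div, abs_of_pos hzpos, Real.log_div (abs_ne_zero.mpr hm') hzpos.ne'] at hA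
  have hh : logHeight₁ ((s : ℚ) * ((y : ℚ) / z)) ≤ Real.log y + Real.log z :=
    logHeight₁_sign_mul_div_le hy hz hζ
  have hΘ := theta_nonneg (zero_le_one.trans hK) y z 0
  calc Real.log z - Real.log |(m : ℝ)| = -(Real.log |(m : ℝ)| - Real.log z) := by ring
    _ < theta K y z 0 * Real.log (max (Real.exp 1) (logHeight₁ ((s : ℚ) * ((y : ℚ) / z)))) := hA
    _ ≤ theta K y z 0 * Real.log (max (Real.exp 1) (Real.log y + Real.log z)) :=
        mul_le_mul_of_nonneg_left (log_max_exp_mono hh) hΘ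

/-- **A2 · `orl_padic_dvd` [M−, ≈45 ll., the hardest helper]** `p`-adic clause in DIVISOR form: for
`d ∣ |m|`, `log d ≤ Θ₀(y,z) · log max(e, log y + log z) · 3Σ_{p∣d} p`
(per prime `p ∣ d`: `p ∤ z` since `gcd(m,z) = gcd(y,z) = 1`; `padicValRat p (m/z) = ν_p(m) ≥ ν_p(d)` by R10;
clause (ii) of R1; R6; then sum with R7 — literally the `hsum` block of `Literature.Barriers.ABC.log_lt_route_a`). -/
theorem orl_padic_dvd {K : ℝ} (hK : 1 ≤ K) (hP : PastenApproximationBound K) {y z : ℕ} (hy : y ≠ 0) (hz : z ≠ 0)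
    (hyz : y.Coprime z) (h1 : 1 < y * z) {s : ℤ} (hs : s = 1 ∨ s = -1) (hm : (z : ℤ) - s * y ≠ 0)
    {d : ℕ} (hd : d ∣ ((z : ℤ) - s * y).natAbs) :
    Real.log d ≤ theta K y z 0 * Real.log (max (Real.exp 1) (Real.log y + Real.log z)) *
      (3 * ∑ p ∈ d.primeFactors, (p : ℝ)) := by
  set m : ℤ := (z : ℤ) - s * y with hm_def
  set Θ := theta K y z 0 with hΘ
  set Y := Real.log (max (Real.exp 1) (Real.log y + Real.log z)) with hY
  have hY1 : 1 ≤ Y := one_le_log_max_exp _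
  have hΘ0 : 0 ≤ Θ := theta_nonneg (zero_le_one.trans hK) y z 0
  have hz' : (z : ℚ) ≠ 0 := by exact_mod_cast hz
  have hζ : (s : ℚ) = 1 ∨ (s : ℚ) = -1 := by
    rcases hs with hs1 | hs1 <;> simp [hs1]
  have hsub : (1 : ℚ) - (s : ℚ) * ((y : ℚ) / z) = (m : ℚ) / z := by
    rw [eq_div_iff hz', sub_mul, one_mul, mul_assoc, div_mul_cancel₀ _ hz', hm_def]
    push_cast; ring
  have hξ1 : (s : ℚ) * ((y : ℚ) / z) ≠ 1 := by
    intro h'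
    have h0 : (m : ℚ) / z = 0 := by rw [← hsub, h', sub_self]
    rcases div_eq_zero_iff.mp h0 with h'' | h''
    · exact hm (by exact_mod_cast h'')
    · exact hz' h''
  obtain ⟨-, hN⟩ := approx_div hK hP hy hz hyz h1 0 hζ hξ1
  have hh : logHeight₁ ((s : ℚ) * ((y : ℚ) / z)) ≤ Real.log y + Real.log z :=
    logHeight₁_sign_mul_div_le hy hz hζ
  have hm0 : m.natAbs ≠ 0 := Int.natAbs_ne_zero.mpr hm
  have hd0 : d ≠ 0 := by rintro rfl; exact hm0 (Nat.eq_zero_of_zero_dvd hd)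
  have hlogd : Real.log d = ∑ p ∈ d.primeFactors, (d.factorization p : ℝ) * Real.log p :=
    log_eq_sum_factorization_mul_log hd0
  have hsum : ∑ p ∈ d.primeFactors, (d.factorization p : ℝ) * Real.log p ≤
      ∑ p ∈ d.primeFactors, Θ * (3 * p * Y) := by
    refine Finset.sum_le_sum fun p hp => ?_
    have hp' := Nat.prime_of_mem_primeFactors hp
    have hpm : p ∣ m.natAbs := (Nat.dvd_of_mem_primeFactors hp).trans hd
    -- `p ∤ z`: a common prime of `m = z - s·y` and `z` divides `s·y = ±y`, against `gcd(y,z) = 1`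
    have hpz : ¬p ∣ z := by
      intro hpz
      have h₁ : (p : ℤ) ∣ m := Int.ofNat_dvd_left.mpr hpm
      have h₂ : (p : ℤ) ∣ (z : ℤ) := Int.natCast_dvd_natCast.mpr hpz
      have h₃ : (p : ℤ) ∣ s * y := by
        have := dvd_sub h₂ h₁
        rwa [hm_def, sub_sub_cancel] at this
      have h₄ : (p : ℤ) ∣ (y : ℤ) := by
        rcases hs with hs1 | hs1 <;> rw [hs1] at h₃
        · rwa [one_mul] at h₃
        · rwa [neg_one_mul, dvd_neg] at h₃
      have hpy : p ∣ y := Int.natCast_dvd_natCast.mp h₄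
      exact hp'.one_lt.ne' (Nat.dvd_one.mp (hyz.gcd_eq_one ▸ Nat.dvd_gcd hpy hpz))
    have hNp := hN p hp'
    rw [hsub] at hNp
    -- `ord_p(m/z) = ν_p(m)` since `p ∤ z`
    have hval : padicValRat p ((m : ℚ) / z) = (m.natAbs.factorization p : ℤ) := by
      haveI : Fact p.Prime := ⟨hp'⟩
      rw [padicValRat.div (by exact_mod_cast hm) hz', padicValRat.of_int, padicValRat.of_nat,
        padicValNat.eq_zero_of_not_dvd hpz, Nat.factorization_def _ hp']
      simp [padicValInt]
    rw [hval] at hNp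
    push_cast at hNp
    have h2 : (p : ℝ) / Real.log p * (Real.log p + Y) ≤ 3 * p * Y :=
      div_log_mul_add_le (by exact_mod_cast hp'.two_le) hY1
    have hfac : (d.factorization p : ℝ) ≤ m.natAbs.factorization p := by
      exact_mod_cast Finsupp.le_def.mp ((Nat.factorization_le_iff_dvd hd0 hm0).mpr hd) p
    have hp1 : (1 : ℝ) ≤ p := by exact_mod_cast hp'.one_lt.le
    have hlogp : 0 ≤ Real.log p := Real.log_nonneg hp1
    have hpl : 0 ≤ (p : ℝ) / Real.log p := div_nonneg (by linarith) hlogp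
    have h3 : (p : ℝ) / Real.log p *
          Real.log (max (Real.exp 1) (p * logHeight₁ ((s : ℚ) * ((y : ℚ) / z)))) ≤
        (p : ℝ) / Real.log p * (Real.log p + Y) :=
      mul_le_mul_of_nonneg_left ((log_max_exp_mul_le hp1).trans
        (by linarith [log_max_exp_mono (t₁ := logHeight₁ ((s : ℚ) * ((y : ℚ) / z))) hh])) hpl
    calc (d.factorization p : ℝ) * Real.log p ≤ (m.natAbs.factorization p : ℝ) * Real.log p :=
          mul_le_mul_of_nonneg_right hfac hlogp
      _ ≤ Θ * ((p : ℝ) / Real.log p *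
            Real.log (max (Real.exp 1) (p * logHeight₁ ((s : ℚ) * ((y : ℚ) / z))))) := hNp.le
      _ ≤ Θ * ((p : ℝ) / Real.log p * (Real.log p + Y)) := mul_le_mul_of_nonneg_left h3 hΘ0
      _ ≤ Θ * (3 * p * Y) := mul_le_mul_of_nonneg_left h2 hΘ0
  have hsum' : ∑ p ∈ d.primeFactors, Θ * (3 * p * Y) =
      Θ * Y * (3 * ∑ p ∈ d.primeFactors, (p : ℝ)) := by
    rw [Finset.mul_sum, Finset.mul_sum]
    exact Finset.sum_congr rfl fun p _ => by ring
  rw [hlogd, ← hsum']; exact hsum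

/-! ## §4 FILE C, part 1 — cusp data: the hypotheses of A1/A2 at `(y, z, s) = (|Q|, w², −sgn Q)`, `m = M`, `d = |u|` -/

/-- **B1 [XS]** the dirty member of the call IS `M = u(u − 11w)`: `w² − (−sgn Q)·|Q| = w² + Q` (R10 `Int.sign_mul_natAbs`, `t0`). -/
theorem mem_eq_call (u w : ℤ) :
    ((w.natAbs ^ 2 : ℕ) : ℤ) - (-(Q u w).sign) * (((Q u w).natAbs : ℕ) : ℤ) = Mem u w := by
  rw [Nat.cast_pow, Int.natAbs_sq, neg_mul, sub_neg_eq_add, Int.sign_mul_natAbs]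
  exact t0 u w

/-- **B2 [XS]** the sign is admissible: `Q ≠ 0 ⇒ −sgn Q = 1 ∨ −sgn Q = −1`. -/
theorem neg_sign_cases {u w : ℤ} (hQ : Q u w ≠ 0) : -(Q u w).sign = 1 ∨ -(Q u w).sign = -1 := by
  rcases lt_or_gt_of_ne hQ with h | h
  · left; rw [Int.sign_eq_neg_one_of_neg h]; norm_num
  · right; rw [Int.sign_eq_one_of_pos h]

/-- **B3 [XS]** `gcd(|Q|, w²) = 1` (R9 `isCoprime_quadForm_right`, `Int.isCoprime_iff_gcd_eq_one`, `Nat.Coprime.pow_right`). -/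
theorem coprime_call {u w : ℤ} (h : IsCoprime u w) : ((Q u w).natAbs).Coprime (w.natAbs ^ 2) := by
  -- proof recycled from k1-GEN4 `coprime_Q_wsq` / k2-GEN4 `coprime_xy_u`
  have h1 : Int.gcd (Q u w) w = 1 := Int.isCoprime_iff_gcd_eq_one.mp (isCoprime_quadForm_right h).symm
  exact Nat.Coprime.pow_right 2 h1

/-- **B4 [S−]** `|Q|·w² > 1` off the escape: `|Q| w² = 1` forces `w = ±1`, `u(u ∓ 11) = 1 + Q ∈ {0, 2}`; `0` is the
escape `u = 11w`, `2` has no integer solution. -/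
theorem one_lt_call {u w : ℤ} (h : IsCoprime u w) (h0 : u * w * Q u w ≠ 0) (hne : u - 11 * w ≠ 0) :
    1 < (Q u w).natAbs * w.natAbs ^ 2 := by
  have hu : u ≠ 0 := by rintro rfl; simp at h0
  have hw : w ≠ 0 := by rintro rfl; simp at h0
  have hQ : Q u w ≠ 0 := by intro hq; apply h0; rw [hq, mul_zero]
  have h1 : 1 ≤ (Q u w).natAbs := Nat.one_le_iff_ne_zero.mpr (Int.natAbs_ne_zero.mpr hQ)
  have h2 : 1 ≤ w.natAbs := Nat.one_le_iff_ne_zero.mpr (Int.natAbs_ne_zero.mpr hw)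
  have h2' : 1 ≤ w.natAbs ^ 2 := Nat.one_le_pow _ _ h2
  by_contra hcon
  push Not at hcon
  have hQ1 : (Q u w).natAbs = 1 := by
    have : (Q u w).natAbs ≤ 1 :=
      calc (Q u w).natAbs = (Q u w).natAbs * 1 := (mul_one _).symm
        _ ≤ (Q u w).natAbs * w.natAbs ^ 2 := Nat.mul_le_mul_left _ h2'
        _ ≤ 1 := hcon
    omega
  have hw1 : w.natAbs = 1 := by
    have hle : w.natAbs ^ 2 ≤ 1 :=
      calc w.natAbs ^ 2 = 1 * w.natAbs ^ 2 := (one_mul _).symm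
        _ ≤ (Q u w).natAbs * w.natAbs ^ 2 := Nat.mul_le_mul_right _ h1
        _ ≤ 1 := hcon
    by_contra hne1
    have h22 : 2 ≤ w.natAbs := by omega
    have h4 : 2 ^ 2 ≤ w.natAbs ^ 2 := Nat.pow_le_pow_left h22 2
    norm_num at h4
    omega
  have hw' : w = 1 ∨ w = -1 := by
    have := Int.natAbs_eq_iff.mp hw1
    push_cast at this
    exact this
  have hq' : Q u w = 1 ∨ Q u w = -1 := by
    have := Int.natAbs_eq_iff.mp hQ1
    push_cast at this
    exact this
  rcases hw' with rfl | rfl <;> rcases hq' with hq | hq <;> simp only [Q] at hq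
  · -- `w = 1`, `Q = 1`: `(2u − 11)² = 129`, impossible
    have ht : (2 * u - 11) ^ 2 = 129 := by linear_combination 4 * hq
    rcases (by omega : (2 * u - 11 ≤ -12) ∨ (-11 ≤ 2 * u - 11 ∧ 2 * u - 11 ≤ 0) ∨
        (0 ≤ 2 * u - 11 ∧ 2 * u - 11 ≤ 11) ∨ 12 ≤ 2 * u - 11) with ht' | ht' | ht' | ht' <;> nlinarith
  · -- `w = 1`, `Q = −1`: `u(u − 11) = 0`, the escape
    have ht : u * (u - 11) = 0 := by linear_combination hq
    rcases mul_eq_zero.mp ht with h' | h'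
    · exact hu h'
    · exact hne (by linarith)
  · -- `w = −1`, `Q = 1`: `(2u + 11)² = 129`
    have ht : (2 * u + 11) ^ 2 = 129 := by linear_combination 4 * hq
    rcases (by omega : (2 * u + 11 ≤ -12) ∨ (-11 ≤ 2 * u + 11 ∧ 2 * u + 11 ≤ 0) ∨
        (0 ≤ 2 * u + 11 ∧ 2 * u + 11 ≤ 11) ∨ 12 ≤ 2 * u + 11) with ht' | ht' | ht' | ht' <;> nlinarith
  · -- `w = −1`, `Q = −1`: `u(u + 11) = 0`, the escape `(−11, −1)`
    have ht : u * (u + 11) = 0 := by linear_combination hq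
    rcases mul_eq_zero.mp ht with h' | h'
    · exact hu h'
    · exact hne (by linarith)

/-- **B5 [XS]** `M ≠ 0` off the escape (`u ≠ 0`, `u ≠ 11w`), in the shape A1/A2 want. -/
theorem mem_ne_zero_call {u w : ℤ} (h0 : u * w * Q u w ≠ 0) (hne : u - 11 * w ≠ 0) :
    ((w.natAbs ^ 2 : ℕ) : ℤ) - (-(Q u w).sign) * (((Q u w).natAbs : ℕ) : ℤ) ≠ 0 := by
  rw [mem_eq_call]
  have hu : u ≠ 0 := by rintro rfl; simp at h0
  exact mul_ne_zero hu hne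

/-- **B6 [XS]** `|u| ∣ |M|` (R10 `Int.natAbs_mul`). -/
theorem natAbs_dvd_mem (u w : ℤ) : u.natAbs ∣ (Mem u w).natAbs := by
  rw [Int.natAbs_mul]; exact dvd_mul_right _ _

/-- **B7 [XS]** the escape `u = 11w` forces `(u,w) = ±(11,1)` by coprimality, so `H = 11`. -/
theorem escape {u w : ℤ} (h : IsCoprime u w) (he : u - 11 * w = 0) : H u w = 11 := by
  have hu : u = 11 * w := sub_eq_zero.mp he
  rw [hu] at h
  have hw : IsUnit w := isCoprime_self.mp h.of_mul_left_right
  have key : ∀ a b : ℝ, |a| = 11 → |b| = 1 → max |a| |b| = 11 := by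
    intro a b ha hb; rw [ha, hb]; exact max_eq_left (by norm_num)
  rcases Int.isUnit_iff.mp hw with hw1 | hw1
  · refine key _ _ ?_ ?_
    · rw [hu, hw1]; push_cast; exact abs_of_nonneg (by norm_num)
    · rw [hw1]; push_cast; exact abs_one
  · refine key _ _ ?_ ?_
    · rw [hu, hw1]; push_cast; rw [abs_neg]; exact abs_of_nonneg (by norm_num)
    · rw [hw1]; push_cast; rw [abs_neg]; exact abs_one

/-! ## §5 FILE C, part 2 — the two cusp consequences and the pre-bound -/

/-- **C1 [XS after A2 + B1–B6]** `log|u| ≤ Θ₀ · Y · 3Σ_{p∣u} p` (`log|u| = log (u.natAbs : ℝ)` by `Nat.cast_natAbs`/`Int.cast_abs`). -/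
theorem cusp_padic {K : ℝ} (hK : 1 ≤ K) (hP : PastenApproximationBound K) {u w : ℤ}
    (h : IsCoprime u w) (h0 : u * w * Q u w ≠ 0) (hne : u - 11 * w ≠ 0) :
    Real.log |(u : ℝ)| ≤ Th K u w * Ycall u w * (3 * ∑ p ∈ u.natAbs.primeFactors, (p : ℝ)) := by
  have hw : w ≠ 0 := by rintro rfl; simp at h0
  have hQ : Q u w ≠ 0 := by intro hq; apply h0; rw [hq, mul_zero]
  have hy : (Q u w).natAbs ≠ 0 := Int.natAbs_ne_zero.mpr hQ
  have hz : w.natAbs ^ 2 ≠ 0 := pow_ne_zero _ (Int.natAbs_ne_zero.mpr hw)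
  have hd : u.natAbs ∣ (((w.natAbs ^ 2 : ℕ) : ℤ) - (-(Q u w).sign) * (((Q u w).natAbs : ℕ) : ℤ)).natAbs := by
    rw [mem_eq_call]; exact natAbs_dvd_mem u w
  have key := orl_padic_dvd hK hP hy hz (coprime_call h) (one_lt_call h h0 hne) (neg_sign_cases hQ)
    (mem_ne_zero_call h0 hne) hd
  have hcast : Real.log |(u : ℝ)| = Real.log (u.natAbs : ℝ) := by
    rw [Nat.cast_natAbs, Int.cast_abs]
  rw [hcast]
  exact key

/-- **C2 [S]** the regime-free transfer: `log H ≤ log|u| + log 12 + Θ₀·Y`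
(`|w| ≤ |u|`: trivial as `Θ₀ Y ≥ 0`; `|u| < |w|`: A1 gives `2 log|w| < log|u| + log|u − 11w| + Θ₀Y` and `|u − 11w| < 12|w|`). -/
theorem cusp_transfer {K : ℝ} (hK : 1 ≤ K) (hP : PastenApproximationBound K) {u w : ℤ}
    (h : IsCoprime u w) (h0 : u * w * Q u w ≠ 0) (hne : u - 11 * w ≠ 0) :
    Real.log (H u w) ≤ Real.log |(u : ℝ)| + Real.log 12 + Th K u w * Ycall u w := by
  have hu : u ≠ 0 := by rintro rfl; simp at h0
  have hw : w ≠ 0 := by rintro rfl; simp at h0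
  have hQ : Q u w ≠ 0 := by intro hq; apply h0; rw [hq, mul_zero]
  have hy : (Q u w).natAbs ≠ 0 := Int.natAbs_ne_zero.mpr hQ
  have hz : w.natAbs ^ 2 ≠ 0 := pow_ne_zero _ (Int.natAbs_ne_zero.mpr hw)
  have hTY : 0 ≤ Th K u w * Ycall u w :=
    mul_nonneg (theta_nonneg (zero_le_one.trans hK) _ _ _) (zero_le_one.trans (one_le_log_max_exp _))
  have h12 : (0 : ℝ) ≤ Real.log 12 := Real.log_nonneg (by norm_num)
  rcases le_or_gt |(w : ℝ)| |(u : ℝ)| with hle | hlt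
  · rw [show H u w = |(u : ℝ)| from max_eq_left hle]; linarith
  · rw [show H u w = |(w : ℝ)| from max_eq_right hlt.le]
    have key : Real.log (((w.natAbs ^ 2 : ℕ)) : ℝ) - Real.log |((Mem u w : ℤ) : ℝ)| < Th K u w * Ycall u w := by
      have := orl_arch hK hP hy hz (coprime_call h) (one_lt_call h h0 hne) (neg_sign_cases hQ)
        (mem_ne_zero_call h0 hne)
      rwa [mem_eq_call] at this
    have hu' : (u : ℝ) ≠ 0 := by exact_mod_cast hu
    have hw' : (w : ℝ) ≠ 0 := by exact_mod_cast hw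
    have hne' : (u : ℝ) - 11 * w ≠ 0 := by exact_mod_cast hne
    have h1 : Real.log (((w.natAbs ^ 2 : ℕ)) : ℝ) = 2 * Real.log |(w : ℝ)| := by
      rw [Nat.cast_pow, Nat.cast_natAbs, Int.cast_abs, Real.log_pow]; norm_num
    have h2 : Real.log |((Mem u w : ℤ) : ℝ)| = Real.log |(u : ℝ)| + Real.log |(u : ℝ) - 11 * w| := by
      show Real.log |((u * (u - 11 * w) : ℤ) : ℝ)| = _
      push_cast
      rw [abs_mul, Real.log_mul (abs_ne_zero.mpr hu') (abs_ne_zero.mpr hne')]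
    have h3 : |(u : ℝ) - 11 * w| < 12 * |(w : ℝ)| := by
      have := abs_sub (u : ℝ) (11 * w)
      rw [abs_mul, abs_of_pos (by norm_num : (0:ℝ) < 11)] at this
      linarith
    have h4 : Real.log |(u : ℝ) - 11 * w| ≤ Real.log 12 + Real.log |(w : ℝ)| := by
      rw [← Real.log_mul (by norm_num) (abs_ne_zero.mpr hw')]
      exact Real.log_le_log (abs_pos.mpr hne') h3.le
    rw [h1, h2] at key
    linarith

/-- **D1 [S]** radical bookkeeping for R4: `rad |Q| w² |u| = rad(u·w·Q)` in `ℕ`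
(`rad_def`, `Nat.primeFactors_mul/pow` or `Nat.radical` multiplicativity, `Int.natAbs_mul/pow`, `Int.radical_natAbs_eq_radical`). -/
theorem rad_call_eq {u w : ℤ} (h0 : u * w * Q u w ≠ 0) :
    rad (Q u w).natAbs (w.natAbs ^ 2) u.natAbs = (UniqueFactorizationMonoid.radical (u * w * Q u w)).natAbs := by
  have hu : u.natAbs ≠ 0 := Int.natAbs_ne_zero.mpr (by rintro rfl; simp at h0)
  have hw : w.natAbs ≠ 0 := Int.natAbs_ne_zero.mpr (by rintro rfl; simp at h0)
  have hQ : (Q u w).natAbs ≠ 0 := Int.natAbs_ne_zero.mpr (by intro hq; apply h0; rw [hq, mul_zero])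
  rw [rad, ← Int.radical_natAbs_eq_radical, Int.natAbs_natCast, Int.natAbs_mul, Int.natAbs_mul,
    Nat.radical_eq_prod_primeFactors, Nat.radical_eq_prod_primeFactors,
    Nat.primeFactors_mul (mul_ne_zero hQ (pow_ne_zero 2 hw)) hu, Nat.primeFactors_mul hQ (pow_ne_zero 2 hw),
    Nat.primeFactors_pow _ two_ne_zero, Nat.primeFactors_mul (mul_ne_zero hu hw) hQ, Nat.primeFactors_mul hu hw]
  congr 1
  ext p; simp only [Finset.mem_union]; tauto

/-- **D2 [XS, PROVED modulo D1]** `Θ₀ ≤ K·C·R^η` — receipt R4 + D1. -/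
theorem theta_call_le {K C η : ℝ} (hK : 1 ≤ K) (hη : 0 ≤ η)
    (hC : ∀ S : Finset ℕ, (∀ p ∈ S, p.Prime) → ∏ p ∈ S, K * Real.log p / (p : ℝ) ^ η ≤ C)
    {u w : ℤ} (h : IsCoprime u w) (h0 : u * w * Q u w ≠ 0) :
    Th K u w ≤ K * C * (((UniqueFactorizationMonoid.radical (u * w * Q u w)).natAbs : ℕ) : ℝ) ^ η := by
  have hu : u.natAbs ≠ 0 := Int.natAbs_ne_zero.mpr (by rintro rfl; simp at h0)
  have hw : w.natAbs ^ 2 ≠ 0 := pow_ne_zero _ (Int.natAbs_ne_zero.mpr (by rintro rfl; simp at h0))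
  have hQ : (Q u w).natAbs ≠ 0 := Int.natAbs_ne_zero.mpr (by intro hq; apply h0; rw [hq, mul_zero])
  have key := SingleTowerSzpiroLine.theta_zero_le_mul_rpow hK hη hC hQ hw (coprime_call h)
    (dvd_mul_right _ u.natAbs) (mul_ne_zero (mul_ne_zero hQ hw) hu)
  rwa [rad_call_eq h0] at key

/-- `rad z = ∏_{p ∣ z} p` as reals (`Int.radical_natAbs_eq_radical`, `Nat.radical_eq_prod_primeFactors`). -/
theorem natAbs_radical_cast (z : ℤ) :
    radR z = ∏ p ∈ z.natAbs.primeFactors, (p : ℝ) := by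
  -- proof recycled from k1-GEN4 `natAbs_radical_cast`
  show (((UniqueFactorizationMonoid.radical z).natAbs : ℕ) : ℝ) = _
  rw [← Int.radical_natAbs_eq_radical, Int.natAbs_natCast, Nat.radical_eq_prod_primeFactors, Nat.cast_prod]

/-- `1 ≤ rad z` (empty product at `z = 0`). -/
theorem one_le_radR (z : ℤ) : 1 ≤ radR z := by
  rw [natAbs_radical_cast z, ← Nat.cast_prod]
  have : 0 < ∏ p ∈ z.natAbs.primeFactors, p :=
    Finset.prod_pos fun p hp => (Nat.prime_of_mem_primeFactors hp).pos
  exact Nat.one_le_cast.mpr (Nat.one_le_iff_ne_zero.mpr this.ne')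

/-- `rad(u·w·Q) = rad u · rad w · rad Q` as reals (R9). -/
theorem radR_prod {u w : ℤ} (h : IsCoprime u w) : radR (u * w * Q u w) = radR u * radR w * radR (Q u w) := by
  show (((UniqueFactorizationMonoid.radical (u * w * (u ^ 2 - 11 * u * w - w ^ 2))).natAbs : ℕ) : ℝ) =
    (((UniqueFactorizationMonoid.radical u).natAbs : ℕ) : ℝ) * (((UniqueFactorizationMonoid.radical w).natAbs : ℕ) : ℝ) *
      (((UniqueFactorizationMonoid.radical (u ^ 2 - 11 * u * w - w ^ 2)).natAbs : ℕ) : ℝ)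
  rw [natAbs_radical_prod h, Nat.cast_mul, Nat.cast_mul]

/-- `rad u ≤ rad(u·w·Q)`. -/
theorem radR_le_radR_prod {u w : ℤ} (h : IsCoprime u w) : radR u ≤ radR (u * w * Q u w) := by
  have hb := one_le_radR w
  have hc := one_le_radR (Q u w)
  have h0u : 0 ≤ radR u := Nat.cast_nonneg _
  rw [radR_prod h]
  calc radR u = radR u * 1 * 1 := by ring
    _ ≤ radR u * radR w * radR (Q u w) :=
        mul_le_mul (mul_le_mul_of_nonneg_left hb h0u) hc zero_le_one (mul_nonneg h0u (zero_le_one.trans hb))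

/-- **D3 [XS]** `1 + 3Σ_{p∣u} p ≤ 4·rad u` (R7 `sum_le_prod_of_two_le`, `rad u = ∏_{p∣u} p ≥ 1`). -/
theorem one_add_three_sum_le (u : ℤ) :
    1 + 3 * ∑ p ∈ u.natAbs.primeFactors, (p : ℝ) ≤ 4 * radR u := by
  rw [natAbs_radical_cast u]
  have hs : ∑ p ∈ u.natAbs.primeFactors, p ≤ ∏ p ∈ u.natAbs.primeFactors, p :=
    sum_le_prod_of_two_le fun p hp => (Nat.prime_of_mem_primeFactors hp).two_le
  have hs' : (∑ p ∈ u.natAbs.primeFactors, (p : ℝ)) ≤ ∏ p ∈ u.natAbs.primeFactors, (p : ℝ) :=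
    calc (∑ p ∈ u.natAbs.primeFactors, (p : ℝ)) = ((∑ p ∈ u.natAbs.primeFactors, p : ℕ) : ℝ) :=
          (Nat.cast_sum _ _).symm
      _ ≤ ((∏ p ∈ u.natAbs.primeFactors, p : ℕ) : ℝ) := Nat.cast_le.mpr hs
      _ = ∏ p ∈ u.natAbs.primeFactors, (p : ℝ) := Nat.cast_prod _ _
  have h1 : (1 : ℝ) ≤ ∏ p ∈ u.natAbs.primeFactors, (p : ℝ) := by
    have : 0 < ∏ p ∈ u.natAbs.primeFactors, p :=
      Finset.prod_pos fun p hp => (Nat.prime_of_mem_primeFactors hp).pos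
    rw [← Nat.cast_prod]
    exact Nat.one_le_cast.mpr (Nat.one_le_iff_ne_zero.mpr this.ne')
  linarith

/-- **D4 [S]** sizes: `Y ≤ log max(e, 2y)` with the LINEARISED variable `y = log 13 + 2 log H` (k2-g5):
`|Q| ≤ 13H²`, `w² ≤ H²`, so `log|Q| + log w² ≤ log 13 + 4 log H ≤ 2y`. -/
theorem Ycall_le {u w : ℤ} (h0 : u * w * Q u w ≠ 0) :
    Ycall u w ≤ Real.log (max (Real.exp 1) (2 * (Real.log 13 + 2 * Real.log (H u w)))) := by
  have hu : u ≠ 0 := by rintro rfl; simp at h0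
  have hw : w ≠ 0 := by rintro rfl; simp at h0
  have hQ : Q u w ≠ 0 := by intro hq; apply h0; rw [hq, mul_zero]
  have hw' : (w : ℝ) ≠ 0 := by exact_mod_cast hw
  have hQ' : ((Q u w : ℤ) : ℝ) ≠ 0 := by exact_mod_cast hQ
  set Hr := H u w with hHr
  have hxH : |(u : ℝ)| ≤ Hr := le_max_left _ _
  have hyH : |(w : ℝ)| ≤ Hr := le_max_right _ _
  have hH1 : 1 ≤ Hr := by
    have : (1 : ℝ) ≤ |(u : ℝ)| := by exact_mod_cast Int.one_le_abs hu
    exact this.trans hxH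
  have hH0 : 0 ≤ Hr := zero_le_one.trans hH1
  have hx2 : (u : ℝ) ^ 2 ≤ Hr ^ 2 := by rw [← sq_abs]; exact pow_le_pow_left₀ (abs_nonneg _) hxH 2
  have hy2 : (w : ℝ) ^ 2 ≤ Hr ^ 2 := by rw [← sq_abs]; exact pow_le_pow_left₀ (abs_nonneg _) hyH 2
  have hxy : |(u : ℝ) * w| ≤ Hr ^ 2 := by
    rw [abs_mul, sq]; exact mul_le_mul hxH hyH (abs_nonneg _) hH0
  have hQle : |((Q u w : ℤ) : ℝ)| ≤ 13 * Hr ^ 2 := by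
    show |((u ^ 2 - 11 * u * w - w ^ 2 : ℤ) : ℝ)| ≤ _
    push_cast
    rw [abs_le]
    constructor <;> nlinarith [le_abs_self ((u : ℝ) * w), neg_abs_le ((u : ℝ) * w), sq_nonneg (u : ℝ),
      sq_nonneg (w : ℝ)]
  have hlogQ : Real.log (((Q u w).natAbs : ℕ) : ℝ) ≤ Real.log 13 + 2 * Real.log Hr := by
    rw [Nat.cast_natAbs, Int.cast_abs]
    calc Real.log |((Q u w : ℤ) : ℝ)| ≤ Real.log (13 * Hr ^ 2) := Real.log_le_log (abs_pos.mpr hQ') hQle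
      _ = Real.log 13 + 2 * Real.log Hr := by
          rw [Real.log_mul (by norm_num) (pow_ne_zero _ (by linarith)), Real.log_pow]; norm_num
  have hlogw : Real.log (((w.natAbs ^ 2 : ℕ)) : ℝ) ≤ 2 * Real.log Hr := by
    rw [Nat.cast_pow, Nat.cast_natAbs, Int.cast_abs, Real.log_pow]
    have := Real.log_le_log (abs_pos.mpr hw') hyH
    push_cast; linarith
  have h13 : (0 : ℝ) ≤ Real.log 13 := Real.log_nonneg (by norm_num)
  exact log_max_exp_mono (by linarith)

/-- **D5 [M−, ≈50 ll.]** the PRE-BOUND for the linearised variable: for every `η > 0` a constant `A ≥ 1` with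
`y ≤ A · R^η · rad u · log max(e, 2y)`, `y = log 13 + 2 log H`, for ALL admissible pairs
(`C` from R5 with `A := K`; off the escape: C1 + C2 + D2 + D3 + D4, `log H ≤ log 12 + Θ₀Y(1 + 3Σ)`, `A := log 1872 + 8KC`;
at the escape: B7, `y = log 1573 ≤ A`, all other factors `≥ 1`). -/
theorem pre_routeU {K : ℝ} (hK : 1 ≤ K) (hP : PastenApproximationBound K) {η : ℝ} (hη : 0 < η) :
    ∃ A : ℝ, 1 ≤ A ∧ ∀ u w : ℤ, IsCoprime u w → u * w * Q u w ≠ 0 →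
      Real.log 13 + 2 * Real.log (H u w) ≤
        A * (((UniqueFactorizationMonoid.radical (u * w * Q u w)).natAbs : ℕ) : ℝ) ^ η * radR u *
          Real.log (max (Real.exp 1) (2 * (Real.log 13 + 2 * Real.log (H u w)))) := by
  obtain ⟨C, hC1, hC⟩ := SingleTowerSzpiroLine.exists_prod_mul_log_div_rpow_le (zero_le_one.trans hK) hη
  have h13 : 0 ≤ Real.log 13 := Real.log_nonneg (by norm_num)
  have h12 : 0 ≤ Real.log 12 := Real.log_nonneg (by norm_num)
  have hKC : 1 ≤ K * C := one_le_mul_of_one_le_of_one_le hK hC1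
  refine ⟨Real.log 13 + 2 * Real.log 12 + 8 * K * C, by linarith, fun u w h h0 => ?_⟩
  have hu : u ≠ 0 := by rintro rfl; simp at h0
  set Hr := H u w with hHr
  set Rr : ℝ := (((UniqueFactorizationMonoid.radical (u * w * Q u w)).natAbs : ℕ) : ℝ) with hRr
  set L := Real.log (max (Real.exp 1) (2 * (Real.log 13 + 2 * Real.log Hr))) with hL
  have hL1 : 1 ≤ L := one_le_log_max_exp _
  have hRr1 : 1 ≤ Rr := one_le_radR _
  have hRη1 : 1 ≤ Rr ^ η := Real.one_le_rpow hRr1 hη.le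
  have hru1 : 1 ≤ radR u := one_le_radR u
  have hP1 : 1 ≤ Rr ^ η * radR u * L :=
    one_le_mul_of_one_le_of_one_le (one_le_mul_of_one_le_of_one_le hRη1 hru1) hL1
  have hA0 : 0 ≤ Real.log 13 + 2 * Real.log 12 + 8 * K * C := by linarith
  rcases eq_or_ne (u - 11 * w) 0 with he | hne
  · -- the escape `(u, w) = ±(11, 1)`: `H = 11`, the bound is a constant
    have hH : Hr = 11 := escape h he
    have hy : Real.log 13 + 2 * Real.log Hr ≤ Real.log 13 + 2 * Real.log 12 + 8 * K * C := by
      rw [hH]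
      have : Real.log 11 ≤ Real.log 12 := Real.log_le_log (by norm_num) (by norm_num)
      linarith
    calc Real.log 13 + 2 * Real.log Hr ≤ (Real.log 13 + 2 * Real.log 12 + 8 * K * C) * 1 := by linarith
      _ ≤ (Real.log 13 + 2 * Real.log 12 + 8 * K * C) * (Rr ^ η * radR u * L) :=
          mul_le_mul_of_nonneg_left hP1 hA0
      _ = _ := by ring
  · -- generic pair: C1 + C2 + D2 + D3 + D4
    have hC1' := cusp_padic hK hP h h0 hne
    have hC2 := cusp_transfer hK hP h h0 hne
    have hTh : Th K u w ≤ K * C * Rr ^ η := theta_call_le hK hη.le hC h h0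
    have hTh0 : 0 ≤ Th K u w := theta_nonneg (zero_le_one.trans hK) _ _ _
    have hY : Ycall u w ≤ L := Ycall_le h0
    have hY0 : 0 ≤ Ycall u w := zero_le_one.trans (one_le_log_max_exp _)
    have hS : 1 + 3 * ∑ p ∈ u.natAbs.primeFactors, (p : ℝ) ≤ 4 * radR u := one_add_three_sum_le u
    have hS0 : 0 ≤ ∑ p ∈ u.natAbs.primeFactors, (p : ℝ) := Finset.sum_nonneg fun p _ => Nat.cast_nonneg p
    have hKCR : 0 ≤ K * C * Rr ^ η := mul_nonneg (by linarith) (by linarith)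
    have h1 : Real.log Hr ≤
        Real.log 12 + Th K u w * Ycall u w * (1 + 3 * ∑ p ∈ u.natAbs.primeFactors, (p : ℝ)) := by
      linarith
    have h2 : Th K u w * Ycall u w * (1 + 3 * ∑ p ∈ u.natAbs.primeFactors, (p : ℝ)) ≤
        K * C * Rr ^ η * L * (4 * radR u) :=
      mul_le_mul (mul_le_mul hTh hY hY0 hKCR) hS (by linarith) (mul_nonneg hKCR (by linarith))
    calc Real.log 13 + 2 * Real.log Hr
        ≤ Real.log 13 + 2 * Real.log 12 + 8 * K * C * (Rr ^ η * radR u * L) := by linarith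
      _ ≤ (Real.log 13 + 2 * Real.log 12) * (Rr ^ η * radR u * L) + 8 * K * C * (Rr ^ η * radR u * L) := by
          have : Real.log 13 + 2 * Real.log 12 ≤ (Real.log 13 + 2 * Real.log 12) * (Rr ^ η * radR u * L) :=
            le_mul_of_one_le_right (by linarith) hP1
          linarith
      _ = _ := by ring

/-! ## §6 FILE B — the abstract endgame (pure real analysis, no `u, w`; provable in parallel) and the targets -/

/-- **E1 [S+, ≈50 ll.]** `y_i ≤ A R_i^η m_i log max(e, 2 y_i)` for every `η > 0`, with `1 ≤ m_i ≤ R_i`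
⇒ `y_i ≤ κ_ε R_i^ε m_i` (`η := min ε 1 / 3`, `M := A R^η m ≥ 1`, R8: `y ≤ 2M log 4M`, `log 4M ≤ (4M)^η/η`,
`m^η ≤ R^η`, `2η + η² ≤ ε`, `Real.rpow_le_rpow_of_exponent_le` for `R ≥ 1`). Same statement as k2-g5 `endgame_abstract`. -/
theorem endgame_abstract {ι : Type*} {y R m : ι → ℝ} (hR : ∀ i, 1 ≤ R i) (hm : ∀ i, 1 ≤ m i)
    (hmR : ∀ i, m i ≤ R i)
    (hpre : ∀ η : ℝ, 0 < η → ∃ A : ℝ, ∀ i, y i ≤ A * R i ^ η * m i * Real.log (max (Real.exp 1) (2 * y i))) :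
    ∀ ε : ℝ, 0 < ε → ∃ κ : ℝ, ∀ i, y i ≤ κ * R i ^ ε * m i := by
  intro ε hε
  set η : ℝ := ε / 2 with hη
  have hη0 : 0 < η := by rw [hη]; linarith
  obtain ⟨A, hA⟩ := hpre η hη0
  set A' : ℝ := max A 1 with hA'
  have hA'1 : 1 ≤ A' := le_max_right _ _
  have hAA' : A ≤ A' := le_max_left _ _
  refine ⟨2 * A' * (Real.log (4 * A') + (η + 1) / η), fun i => ?_⟩
  have hRi := hR i
  have hmi := hm i
  have hmRi := hmR i
  have hRpos : 0 < R i := by linarith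
  have hRη1 : 1 ≤ R i ^ η := Real.one_le_rpow hRi hη0.le
  have hRη0 : 0 < R i ^ η := Real.rpow_pos_of_pos hRpos η
  have hlog1 : 1 ≤ Real.log (max (Real.exp 1) (2 * y i)) := one_le_log_max_exp _
  set M : ℝ := A' * R i ^ η * m i with hM
  have hARη : 1 ≤ A' * R i ^ η := one_le_mul_of_one_le_of_one_le hA'1 hRη1
  have hM1 : 1 ≤ M := one_le_mul_of_one_le_of_one_le hARη hmi
  have hpre' : y i ≤ M * Real.log (max (Real.exp 1) (2 * y i)) := by
    refine (hA i).trans (mul_le_mul_of_nonneg_right ?_ (by linarith))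
    exact mul_le_mul_of_nonneg_right (mul_le_mul_of_nonneg_right hAA' hRη0.le) (by linarith)
  -- self-improvement (R8)
  have hy : y i ≤ 2 * M * Real.log (4 * M) := le_of_le_mul_log_max hM1 hpre'
  -- `log (4M) ≤ log (4A') + (η + 1) log R ≤ (log (4A') + (η+1)/η) · R^η`
  have h4M : 4 * M ≤ 4 * A' * R i ^ η * R i := by
    have : A' * R i ^ η * m i ≤ A' * R i ^ η * R i := mul_le_mul_of_nonneg_left hmRi (by linarith)
    linarith
  have h4A : (0 : ℝ) < 4 * A' := by linarith
  have hlog4M : Real.log (4 * M) ≤ Real.log (4 * A') + (η + 1) * Real.log (R i) := by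
    have h1 : Real.log (4 * M) ≤ Real.log (4 * A' * R i ^ η * R i) := Real.log_le_log (by linarith) h4M
    have h2 : Real.log (4 * A' * R i ^ η * R i) = Real.log (4 * A') + (η + 1) * Real.log (R i) := by
      rw [Real.log_mul (mul_pos h4A hRη0).ne' hRpos.ne', Real.log_mul h4A.ne' hRη0.ne', Real.log_rpow hRpos]
      ring
    linarith
  have hlogR : Real.log (R i) ≤ R i ^ η / η := Real.log_le_rpow_div hRpos.le hη0
  have hlogA : 0 ≤ Real.log (4 * A') := Real.log_nonneg (by linarith)
  have hlog4M' : Real.log (4 * M) ≤ (Real.log (4 * A') + (η + 1) / η) * R i ^ η := by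
    have h1 : Real.log (4 * A') ≤ Real.log (4 * A') * R i ^ η := le_mul_of_one_le_right hlogA hRη1
    have h2 : (η + 1) * Real.log (R i) ≤ (η + 1) * (R i ^ η / η) := mul_le_mul_of_nonneg_left hlogR (by linarith)
    have h3 : (η + 1) * (R i ^ η / η) = (η + 1) / η * R i ^ η := by ring
    rw [add_mul]; linarith
  have hM0 : 0 ≤ M := by linarith
  have hRR : R i ^ η * R i ^ η = R i ^ ε := by
    rw [← Real.rpow_add hRpos]; congr 1; rw [hη]; ring
  calc y i ≤ 2 * M * Real.log (4 * M) := hy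
    _ ≤ 2 * M * ((Real.log (4 * A') + (η + 1) / η) * R i ^ η) := mul_le_mul_of_nonneg_left hlog4M' (by linarith)
    _ = 2 * A' * (Real.log (4 * A') + (η + 1) / η) * (R i ^ η * R i ^ η) * m i := by rw [hM]; ring
    _ = 2 * A' * (Real.log (4 * A') + (η + 1) / η) * R i ^ ε * m i := by rw [hRR]

/-- **E2 [S]** `RouteU` from the engine: E1 on the index type of admissible pairs with `y := log 13 + 2 log H`,
`R := rad(uwQ)`, `m := rad u` (D5; `1 ≤ rad u ≤ R` by R9 `natAbs_radical_prod`; `log H ≤ y` since `H ≥ 1`). -/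
theorem routeU_of_engine {K : ℝ} (hK : 1 ≤ K) (hP : PastenApproximationBound K) : RouteU := by
  have main := @endgame_abstract {p : ℤ × ℤ // IsCoprime p.1 p.2 ∧ p.1 * p.2 * Q p.1 p.2 ≠ 0}
    (fun i => Real.log 13 + 2 * Real.log (H i.1.1 i.1.2))
    (fun i => (((UniqueFactorizationMonoid.radical (i.1.1 * i.1.2 * Q i.1.1 i.1.2)).natAbs : ℕ) : ℝ))
    (fun i => radR i.1.1)
    (fun i => one_le_radR _) (fun i => one_le_radR _) (fun i => radR_le_radR_prod i.2.1)
    (fun η hη => by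
      obtain ⟨A, -, hA⟩ := pre_routeU hK hP hη
      exact ⟨A, fun i => hA i.1.1 i.1.2 i.2.1 i.2.2⟩)
  intro ε hε
  obtain ⟨κ, hκ⟩ := main ε hε
  refine ⟨max κ 0, fun u w h h0 => ?_⟩
  set Rr : ℝ := (((UniqueFactorizationMonoid.radical (u * w * (u ^ 2 - 11 * u * w - w ^ 2))).natAbs : ℕ) : ℝ)
    with hRr
  have key : Real.log 13 + 2 * Real.log (H u w) ≤ κ * Rr ^ ε * radR u := hκ ⟨(u, w), h, h0⟩
  have hu : u ≠ 0 := by rintro rfl; simp at h0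
  have hH1 : 1 ≤ H u w := by
    have : (1 : ℝ) ≤ |(u : ℝ)| := by exact_mod_cast Int.one_le_abs hu
    exact this.trans (le_max_left _ _)
  have hlogH : 0 ≤ Real.log (H u w) := Real.log_nonneg hH1
  have h13 : 0 ≤ Real.log 13 := Real.log_nonneg (by norm_num)
  have hRε : 0 ≤ Rr ^ ε := Real.rpow_nonneg (Nat.cast_nonneg _) _
  have hru0 : 0 ≤ radR u := Nat.cast_nonneg _
  calc Real.log (H u w) ≤ Real.log 13 + 2 * Real.log (H u w) := by linarith
    _ ≤ κ * Rr ^ ε * radR u := key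
    _ ≤ max κ 0 * Rr ^ ε * radR u :=
        mul_le_mul_of_nonneg_right (mul_le_mul_of_nonneg_right (le_max_left _ _) hRε) hru0

/-- **E3 [S]** the cusp swap: `RouteU → RouteW` at `(w, −u)` (`IsCoprime.neg_right`/`.symm`, `prod_swap`, `abs_neg`,
`max_comm`, `Int.radical_neg`/`natAbs_neg`). -/
theorem routeW_of_routeU : RouteU → RouteW := by
  intro hU ε hε
  obtain ⟨κ, hκ⟩ := hU ε hε
  refine ⟨κ, fun u w h h0 => ?_⟩
  have hprod : w * -u * (w ^ 2 - 11 * w * -u - (-u) ^ 2) = u * w * (u ^ 2 - 11 * u * w - w ^ 2) := by ring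
  have h0' : w * -u * (w ^ 2 - 11 * w * -u - (-u) ^ 2) ≠ 0 := by rw [hprod]; exact h0
  have key := hκ w (-u) h.symm.neg_right h0'
  rw [hprod] at key
  have hmax : max |((w : ℤ) : ℝ)| |((-u : ℤ) : ℝ)| = max |((u : ℤ) : ℝ)| |((w : ℤ) : ℝ)| := by
    rw [Int.cast_neg, abs_neg, max_comm]
  rw [hmax] at key
  exact key

/-- **E4 [XS]** `RouteU → RouteW → CuspMinRadBound` (`κ := max (max κ_U κ_W) 0`, `min_le_left/right`). -/
theorem cuspMin_of_routes : RouteU → RouteW → CuspMinRadBound := by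
  intro hU hW ε hε
  obtain ⟨κ₁, h₁⟩ := hU ε hε
  obtain ⟨κ₂, h₂⟩ := hW ε hε
  refine ⟨max (max κ₁ κ₂) 0, fun u w h h0 => ?_⟩
  have hR : 0 ≤ (((UniqueFactorizationMonoid.radical (u * w * (u ^ 2 - 11 * u * w - w ^ 2))).natAbs : ℕ) : ℝ)
      ^ (ε : ℝ) := Real.rpow_nonneg (Nat.cast_nonneg _) _
  have hk₁ : κ₁ ≤ max (max κ₁ κ₂) 0 := (le_max_left _ _).trans (le_max_left _ _)
  have hk₂ : κ₂ ≤ max (max κ₁ κ₂) 0 := (le_max_right _ _).trans (le_max_left _ _)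
  rcases min_choice ((((UniqueFactorizationMonoid.radical u).natAbs : ℕ) : ℝ))
      ((((UniqueFactorizationMonoid.radical w).natAbs : ℕ) : ℝ)) with hmin | hmin <;> rw [hmin]
  · exact (h₁ u w h h0).trans
      (mul_le_mul_of_nonneg_right (mul_le_mul_of_nonneg_right hk₁ hR) (Nat.cast_nonneg _))
  · exact (h₂ u w h h0).trans
      (mul_le_mul_of_nonneg_right (mul_le_mul_of_nonneg_right hk₂ hR) (Nat.cast_nonneg _))

/-- **E5 [S]** min-form ⇒ STUB: all radicals `≥ 1`, `min x y ≤ (xy)^{1/2} ≤ (xy)^{2/3}`, `1 ≤ (rad Q)^{1/3}` (`Real.one_le_rpow`). -/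
theorem stubSplit_of_cuspMin : CuspMinRadBound → StubSplit := by
  intro hC ε hε
  obtain ⟨κ, hκ⟩ := hC ε hε
  refine ⟨max κ 0, fun u w h h0 => ?_⟩
  have main := hκ u w h h0
  set R : ℝ := (((UniqueFactorizationMonoid.radical (u * w * (u ^ 2 - 11 * u * w - w ^ 2))).natAbs : ℕ) : ℝ)
    with hR
  set a : ℝ := (((UniqueFactorizationMonoid.radical u).natAbs : ℕ) : ℝ) with ha
  set b : ℝ := (((UniqueFactorizationMonoid.radical w).natAbs : ℕ) : ℝ) with hb
  set c : ℝ := (((UniqueFactorizationMonoid.radical (u ^ 2 - 11 * u * w - w ^ 2)).natAbs : ℕ) : ℝ) with hc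
  have ha1 : 1 ≤ a := one_le_radR u
  have hb1 : 1 ≤ b := one_le_radR w
  have hc1 : 1 ≤ c := one_le_radR _
  have hm0 : 0 ≤ min a b := le_min (by linarith) (by linarith)
  have hab : min a b ^ 2 ≤ a * b := by
    rw [sq]; exact mul_le_mul (min_le_left _ _) (min_le_right _ _) hm0 (by linarith)
  have hab1 : 1 ≤ a * b := one_le_mul_of_one_le_of_one_le ha1 hb1
  have hmin_le : min a b ≤ (a * b) ^ (2 / 3 : ℝ) * c ^ (1 / 3 : ℝ) :=
    calc min a b = Real.sqrt (min a b ^ 2) := (Real.sqrt_sq hm0).symm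
      _ ≤ Real.sqrt (a * b) := Real.sqrt_le_sqrt hab
      _ = (a * b) ^ (1 / 2 : ℝ) := Real.sqrt_eq_rpow _
      _ ≤ (a * b) ^ (2 / 3 : ℝ) := Real.rpow_le_rpow_of_exponent_le hab1 (by norm_num)
      _ = (a * b) ^ (2 / 3 : ℝ) * 1 := (mul_one _).symm
      _ ≤ (a * b) ^ (2 / 3 : ℝ) * c ^ (1 / 3 : ℝ) :=
          mul_le_mul_of_nonneg_left (Real.one_le_rpow hc1 (by norm_num)) (Real.rpow_nonneg (by linarith) _)
  have hR0 : 0 ≤ R := Nat.cast_nonneg _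
  have hRε : 0 ≤ R ^ (ε : ℝ) := Real.rpow_nonneg hR0 _
  have hκ0 : 0 ≤ max κ 0 := le_max_right _ _
  calc Real.log (max |(u : ℝ)| |(w : ℝ)|) ≤ κ * R ^ (ε : ℝ) * min a b := main
    _ ≤ max κ 0 * R ^ (ε : ℝ) * min a b :=
        mul_le_mul_of_nonneg_right (mul_le_mul_of_nonneg_right (le_max_left _ _) hRε) hm0
    _ ≤ max κ 0 * R ^ (ε : ℝ) * ((a * b) ^ (2 / 3 : ℝ) * c ^ (1 / 3 : ℝ)) :=
        mul_le_mul_of_nonneg_left hmin_le (mul_nonneg hκ0 hRε)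

/-- **E6 [S]** min-form ⇒ CRUX: `min(rad u, rad w) ≤ (rad u·rad w)^{1/2} ≤ R^{1/2}` (R9), `R^ε·R^{1/2} = R^{1/2+ε}` (`Real.rpow_add`). -/
theorem goldenCuspShadow_of_cuspMin :
    CuspMinRadBound → Summit.ABC.ABC.Theses.CuspFieldPencil.GoldenCuspShadow := by
  intro hC ε hε
  obtain ⟨κ, hκ⟩ := hC ε hε
  refine ⟨max κ 0, fun u w h h0 => ?_⟩
  have main := hκ u w h h0
  set R : ℝ := (((UniqueFactorizationMonoid.radical (u * w * (u ^ 2 - 11 * u * w - w ^ 2))).natAbs : ℕ) : ℝ)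
    with hR
  set a : ℝ := (((UniqueFactorizationMonoid.radical u).natAbs : ℕ) : ℝ) with ha
  set b : ℝ := (((UniqueFactorizationMonoid.radical w).natAbs : ℕ) : ℝ) with hb
  set c : ℝ := (((UniqueFactorizationMonoid.radical (u ^ 2 - 11 * u * w - w ^ 2)).natAbs : ℕ) : ℝ) with hc
  have ha1 : 1 ≤ a := one_le_radR u
  have hb1 : 1 ≤ b := one_le_radR w
  have hc1 : 1 ≤ c := one_le_radR _
  have hRabc : R = a * b * c := radR_prod h
  have hRpos : 0 < R := by rw [hRabc]; exact mul_pos (mul_pos (by linarith) (by linarith)) (by linarith)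
  have hm0 : 0 ≤ min a b := le_min (by linarith) (by linarith)
  have hmin_sq : min a b ^ 2 ≤ R := by
    rw [hRabc, sq]
    calc min a b * min a b ≤ a * b := mul_le_mul (min_le_left _ _) (min_le_right _ _) hm0 (by linarith)
      _ ≤ a * b * c := le_mul_of_one_le_right (mul_nonneg (by linarith) (by linarith)) hc1
  have hmin_le : min a b ≤ R ^ (1 / 2 : ℝ) := by
    rw [← Real.sqrt_eq_rpow, ← Real.sqrt_sq hm0]
    exact Real.sqrt_le_sqrt hmin_sq
  have hRε : 0 ≤ R ^ (ε : ℝ) := Real.rpow_nonneg hRpos.le _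
  have hκ0 : 0 ≤ max κ 0 := le_max_right _ _
  calc Real.log (max |(u : ℝ)| |(w : ℝ)|) ≤ κ * R ^ (ε : ℝ) * min a b := main
    _ ≤ max κ 0 * R ^ (ε : ℝ) * min a b :=
        mul_le_mul_of_nonneg_right (mul_le_mul_of_nonneg_right (le_max_left _ _) hRε) hm0
    _ ≤ max κ 0 * R ^ (ε : ℝ) * R ^ (1 / 2 : ℝ) := mul_le_mul_of_nonneg_left hmin_le (mul_nonneg hκ0 hRε)
    _ = max κ 0 * R ^ (1 / 2 + ε : ℝ) := by rw [Real.rpow_add hRpos]; ring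

/-! ## §7 Assembly (sorry-free): kernel theorem ⇒ RouteU ⇒ RouteW ⇒ min-form ⇒ STUB ∧ CRUX by name -/

theorem routeU_holds : RouteU := by
  obtain ⟨K, hK, hP⟩ := approximationBound_rat_holds
  exact routeU_of_engine hK hP

theorem routeW_holds : RouteW := routeW_of_routeU routeU_holds

theorem cuspMinRadBound_holds : CuspMinRadBound := cuspMin_of_routes routeU_holds routeW_holds

/-- THE STUB (land with the VERBATIM registered header `theorem stub_splitCuspTriple : <signature> := …`). -/
theorem stubSplit_holds : StubSplit := stubSplit_of_cuspMin cuspMinRadBound_holds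

/-- THE CRUX by name. -/
theorem goldenCuspShadow_holds : Summit.ABC.ABC.Theses.CuspFieldPencil.GoldenCuspShadow :=
  goldenCuspShadow_of_cuspMin cuspMinRadBound_holds

/-! ## §8 Kernel-checked sanity of the call data (cheap falsifiers of B1/B4/B7) -/

/-- B1 at `(1,1)` (`Q = −11`, sign `+1`, `m = 1 − 11 = −10 = M`) and at `(12,1)` (`Q = 11 > 0`, sign `−1`, `m = 1 + 11 = 12 = M`). -/
example : (((1 : ℤ).natAbs ^ 2 : ℕ) : ℤ) - (-(Q 1 1).sign) * (((Q 1 1).natAbs : ℕ) : ℤ) = Mem 1 1 ∧ Mem 1 1 = -10 := by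
  decide
example : (((1 : ℤ).natAbs ^ 2 : ℕ) : ℤ) - (-(Q 12 1).sign) * (((Q 12 1).natAbs : ℕ) : ℤ) = Mem 12 1 ∧ Mem 12 1 = 12 := by
  decide
/-- B4: smallest admissible pairs already have `|Q|·w² ≥ 11`; the escape `(11,1)` is exactly `M = 0`, `|Q|w² = 1`. -/
example : (Q 1 1).natAbs * (1 : ℤ).natAbs ^ 2 = 11 ∧ (Q 12 1).natAbs * (1 : ℤ).natAbs ^ 2 = 11 ∧
    (Q 2 1).natAbs * (1 : ℤ).natAbs ^ 2 = 19 ∧ Mem 11 1 = 0 ∧ (Q 11 1).natAbs * (1 : ℤ).natAbs ^ 2 = 1 := by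
  decide
/-- near the irrational cusp, `(255, 23)`: `|u − 11w| = 2` — the transfer constant `12` is pure slack there. -/
example : (255 : ℤ) - 11 * 23 = 2 ∧ Q 255 23 = -19 := by decide

end Summit.ABC.ABC.Cruxes.GoldenCuspShadow.SplitK1G5

end

/-! ## Axiom audit (kernel): the stub and the crux rest on the standard axioms only. -/
#print axioms Summit.ABC.ABC.Cruxes.GoldenCuspShadow.SplitK1G5.stubSplit_holds
#print axioms Summit.ABC.ABC.Cruxes.GoldenCuspShadow.SplitK1G5.goldenCuspShadow_holds
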